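import Mathlib.LinearAlgebra.Matrix.ToLinearEquiv
import Literature.NumberTheory.GaloisRepresentations.PstWeilDeligneTateTwist
import HarnessLib

/-!
# `⊗`-stability of `B`-admissibility: the comparison isomorphism, equivariant pairings, and the
# twist of a de Rham representation by a de Rham character

Topic `NumberTheory/GaloisRepresentations`; theorems only (no definition, no named fact).  Generic
`p`-adic Hodge theory for an arbitrary period-ring datum `𝔅 : PeriodRingData Γ P E` (accepted
`PAdicHodge`: a Fontaine-regular `(P, Γ)`-ring `B` with `B^Γ = E`, `D_B(V) = (B ⊗_P V)^Γ`,
`IsAdmissible 𝔅 ρ : dim_E D_B(V) = dim_P V`), continuing the accepted `PAdicHodgeProofs` (Fontaine's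
inequality `finrank_D_le_holds`; injectivity of the comparison map, `linearIndependent_of_mem_D`) and
`AdmissibleTwist` (periods of `P`-valued characters are units, `isUnit_of_period`; twists by `P`-valued
characters).  Source: Fontaine, Astérisque 223 (1994), Exposé III, Thm. 1.5.2 — for a regular
`(P, Γ)`-ring `B`, `V` is `B`-admissible iff the comparison map `α_V : B ⊗_E D_B(V) → B ⊗_P V` is an
isomorphism — and Prop. 1.5.2 — the `B`-admissible representations form a sub-Tannakian category of
`Rep_P(Γ)`: stable under sub-objects, quotients, `⊕`, `⊗`, duals.  The tree had the sub-object /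
quotient / `⊕` cases (`isAdmissible_of_shortExact`, `isAdmissible_pi_iff`, `isDeRhamFramed_blocks`),
the twist by a `P`-VALUED character with a period (`isAdmissible_of_twist_period`, Tate twists) and
the surjectivity of `α_V` for a period FIELD `B` (`span_D_eq_top (hB : IsField 𝔅.B)`, file
`UnramifiedLabelledWeightsFinite`); this file adds the comparison isomorphism for every regular `B`
and `⊗`-stability, and deduces that the twist of a de Rham
`ρ : Γ_F →ₜ* GL_n(ℚ̄_ℓ)` by a de Rham CHARACTER `r : Γ_F →ₜ* GL_1(ℚ̄_ℓ)` (values in `ℚ̄_ℓˣ`, finite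
models over `E ⊋ ℚ_ℓ` in general) is de Rham.

## Main results

* `PeriodRingData.exists_basis_mem_D_of_isAdmissible`,
  `PeriodRingData.span_D_eq_top_of_isAdmissible` — **the comparison isomorphism** (Thm. 1.5.2): if
  `V` is `B`-admissible then `B ⊗_P V` has a `B`-basis of `Γ`-invariant
  vectors; in particular `D_B(V)` spans `B ⊗_P V` over `B` (`α_V` is surjective).  Proof (Fontaine's):
  the matrix `C ∈ M_d(B)` of an `E`-basis of `D_B(V)` in the basis `1 ⊗ vᵢ` has `det C ≠ 0` (the basis
  is `B`-free by injectivity of `α_V`, and `B` is a domain) and `ρ(σ) σ(C) = C`, so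
  `det ρ(σ) · σ(det C) = det C`: `det C` is a nonzero period of the `P`-valued character `det ρ`,
  hence a unit by regularity (iii) (accepted `isUnit_of_period`), and `C` is invertible.
* `PeriodRingData.isAdmissible_of_span_D_eq_top`, `PeriodRingData.isAdmissible_iff_span_D_eq_top` — the
  converse: if `D_B(V)` spans `B ⊗_P V` then `V` is admissible (an `E`-basis of `D_B(V)` spans the free
  `B`-module `B ⊗_P V` of rank `dim_P V`, so it has at least `dim_P V` members; with Fontaine's
  inequality).
* `PeriodRingData.isAdmissible_of_pairing` — **`⊗`-stability, in pairing form** (Prop. 1.5.2): if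
  `φ : V₁ × V₂ → V₃` is `P`-bilinear and `Γ`-equivariant with values spanning `V₃`, and `V₁`, `V₂` are
  admissible, then `V₃` is admissible — the `B`-bilinear extension `μ` of `φ`
  (`exists_baseChange_bilinear`) maps `D(V₁) × D(V₂)` into `D(V₃)` (`pairing_mem_D`), and
  `μ(B ⊗ V₁, B ⊗ V₂)` spans `B ⊗ V₃`.  Corollary `PeriodRingData.isAdmissible_tmul`: `V₁ ⊗_P V₂` (with
  any admissible topology making the diagonal action continuous) is admissible.  The pairing form also
  covers `V₁ ⊗_L V₂` for `L`-linear representations (`L/P` finite) and scalar twists, which is how it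
  is used below.
* `PeriodRingData.isAdmissible_restrictScalars_twist_det` — framed form over a coefficient field `E'`
  finite over `P`: if the `P`-restrictions of `rE : Γ →ₜ* GL_n(E')` and of `r₁ : Γ →ₜ* GL_1(E')` are
  admissible, so is that of the twist `rE ⊗ det r₁` (`det r₁ = r₁` is `E'`-valued; the accepted
  `isAdmissible_of_twist` treats `P`-valued characters only).
* `FramedRep.IsDeRhamWith.twist_det`, `PstWeilDeligneData.IsDeRhamFramed.twist_det` — **the twist of a de
  Rham `ρ : Γ_F →ₜ* GL_n(ℚ̄_ℓ)` by the determinant of a de Rham `r : Γ_F →ₜ* GL_1(ℚ̄_ℓ)` is de Rham**,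
  for every `ℚ_ℓ`-structure `alg` and period-ring datum `𝔅` on a field `F` (accepted
  `FramedRep.IsDeRhamWith`), in particular for every `p`-adic Hodge datum `𝔇 : PstWeilDeligneData F ℓ`
  of a non-archimedean local field (accepted `IsDeRhamFramed`).  Bookkeeping: finite models of `ρ`, `r`
  over `E₁`, `E₂ ⊆ ℚ̄_ℓ` are moved to the compositum `E = E₁E₂` (`HasQlModel.baseChange_inclusion`),
  where they stay admissible by model independence (accepted `isAdmissible_of_hasQlModel`), and
  `rE ⊗ det tE` models `ρ ⊗ det r` (accepted `HasQlModel.twist`, with `HasQlModel.coe_det_apply`).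

## References
* [FontaineAsterisque223III] J.-M. Fontaine, *Représentations p-adiques semi-stables*, Astérisque 223
  (1994), Exp. III, §1.4 (regular `(F, G)`-rings), Thm. 1.5.2 (comparison isomorphism), Prop. 1.5.2
  (sub-objects, quotients, `⊕`, `⊗`, duals of `B`-admissible representations).
* [FontaineOuyang2022] J.-M. Fontaine, Y. Ouyang, *Theory of p-adic Galois representations*, Thm. 2.13.
* [BuzzardGeeLMS2014] K. Buzzard, T. Gee, *The conjectural connections between automorphic
  representations and Galois representations* (2014), §2.2 (finite models, coefficient fields).
-/

noncomputable section

open scoped TensorProduct Matrix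
open Field Literature.NumberTheory.Automorphic

namespace Literature.NumberTheory.GaloisRepresentations

/-! ### 0. Base change of a bilinear map -/

/-- **Base change of a bilinear map.**  For a commutative `P`-algebra `B` and a `P`-bilinear
`φ : M₁ × M₂ → M₃` there is a `B`-bilinear `μ : (B ⊗_P M₁) × (B ⊗_P M₂) → B ⊗_P M₃` with
`μ(b ⊗ x, c ⊗ y) = bc ⊗ φ(x, y)` (the composite of Mathlib's `distribBaseChange`,
`B ⊗ (M₁ ⊗ M₂) ≃ (B ⊗ M₁) ⊗_B (B ⊗ M₂)`, with the base change of `M₁ ⊗ M₂ → M₃`; stated as an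
existence theorem, no definition being introduced). [folklore] -/
theorem exists_baseChange_bilinear {P : Type*} [CommRing P] (B : Type*) [CommRing B] [Algebra P B]
    {M₁ M₂ M₃ : Type*} [AddCommGroup M₁] [Module P M₁] [AddCommGroup M₂] [Module P M₂]
    [AddCommGroup M₃] [Module P M₃] (φ : M₁ →ₗ[P] M₂ →ₗ[P] M₃) :
    ∃ μ : B ⊗[P] M₁ →ₗ[B] B ⊗[P] M₂ →ₗ[B] B ⊗[P] M₃,
      ∀ (b c : B) (x : M₁) (y : M₂), μ (b ⊗ₜ x) (c ⊗ₜ y) = (b * c) ⊗ₜ φ x y :=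
  ⟨(TensorProduct.mk B (B ⊗[P] M₁) (B ⊗[P] M₂)).compr₂
      ((TensorProduct.lift φ).baseChange B ∘ₗ
        (TensorProduct.AlgebraTensorModule.distribBaseChange P B M₁ M₂).symm.toLinearMap),
    fun b c x y => by simp⟩

namespace PeriodRingData

-- Mathlib's own global value of `maxSynthPendingDepth` (the project default `1` makes nested
-- instance problems on `𝔅.B ⊗[P] M` fail spuriously; see the note in `PAdicHodgeProofs`).
set_option maxSynthPendingDepth 3

universe u v v' w w'

variable {Γ : Type u} [Group Γ] [TopologicalSpace Γ] {P : Type v} {E : Type v'} [Field P]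
  [TopologicalSpace P] [Field E] [Algebra P E]
  (𝔅 : PeriodRingData.{u, v, v', w} Γ P E)

/-! ### 1. The comparison isomorphism `B ⊗_E D_B(V) ≅ B ⊗_P V` for admissible `V` -/

section Comparison

variable {M : Type w'} [AddCommGroup M] [Module P M] [TopologicalSpace M] (ρ : ContinuousRep Γ P M)

/-- **The comparison isomorphism** (Fontaine, Exp. III, Thm. 1.5.2): if the finite-dimensional
`P`-linear representation `V` of `Γ` is `B`-admissible for the regular `(P, Γ)`-ring `B`, then
`B ⊗_P V` has a `B`-basis consisting of `Γ`-invariant vectors (i.e. `α_V : B ⊗_E D_B(V) → B ⊗_P V` is an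
isomorphism of `B`-modules).  Proof: an `E`-basis `d₁, …, d_m` of `D_B(V)` (`m = dim_P V`) is `B`-free
(injectivity of `α_V`, accepted `linearIndependent_of_mem_D`); its matrix `C` in the basis `1 ⊗ vᵢ` has
`det C ≠ 0` (`B` a domain) and `ρ(σ) · σ(C) = C`, so `det ρ(σ) · σ(det C) = det C` and `det C` is a unit
by regularity (iii) (accepted `isUnit_of_period`); hence `C` is invertible and the `1 ⊗ vᵢ` are
`B`-combinations of the `d_j`. [cite: FontaineAsterisque223III, Exp. III Thm. 1.5.2] -/
theorem exists_basis_mem_D_of_isAdmissible [FiniteDimensional P M] (h : 𝔅.IsAdmissible ρ) :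
    ∃ b : Module.Basis (Fin (Module.finrank P M)) 𝔅.B (𝔅.B ⊗[P] M), ∀ j, b j ∈ 𝔅.D ρ := by
  classical
  haveI := 𝔅.finite_D ρ
  -- bases: `bM` of `V`, `bD` of `D_B(V)` (admissibility: `dim_E D = dim_P V`), `β = 1 ⊗ bM` of `B ⊗ V`
  let bM : Module.Basis (Fin (Module.finrank P M)) P M := Module.finBasis P M
  let bD : Module.Basis (Fin (Module.finrank P M)) E (𝔅.D ρ) :=
    Module.finBasisOfFinrankEq E (𝔅.D ρ) h
  let β : Module.Basis (Fin (Module.finrank P M)) 𝔅.B (𝔅.B ⊗[P] M) :=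
    Algebra.TensorProduct.basis 𝔅.B bM
  have hβ : ∀ i, β i = (1 : 𝔅.B) ⊗ₜ[P] bM i := fun i => Algebra.TensorProduct.basis_apply bM i
  -- the invariant vectors `d j` and their `B`-linear independence
  set d : Fin (Module.finrank P M) → 𝔅.B ⊗[P] M := fun j => (bD j : 𝔅.B ⊗[P] M) with hd_def
  have hdD : ∀ j, d j ∈ 𝔅.D ρ := fun j => (bD j).2
  have hliE : LinearIndependent E d :=
    bD.linearIndependent.map' (𝔅.D ρ).subtype (Submodule.ker_subtype _)
  have hliB : LinearIndependent 𝔅.B d := 𝔅.linearIndependent_of_mem_D ρ hdD hliE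
  clear_value d
  -- coordinates `C` of the `d j` in the basis `β`
  obtain ⟨C, hCdef⟩ : ∃ C : Matrix (Fin (Module.finrank P M)) (Fin (Module.finrank P M)) 𝔅.B,
      ∀ i j, C i j = β.repr (d j) i := ⟨Matrix.of fun i j => β.repr (d j) i, fun _ _ => rfl⟩
  have hd : ∀ j, d j = ∑ i, C i j • β i := fun j => by
    simp_rw [hCdef]
    exact (β.sum_repr (d j)).symm
  -- `det C ≠ 0`: a kernel vector of `C` would be a `B`-linear relation among the `d j`
  have hdet0 : C.det ≠ 0 := by
    intro h0
    obtain ⟨c, hc0, hc⟩ := Matrix.exists_mulVec_eq_zero_iff.2 h0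
    refine hc0 (funext fun j => Fintype.linearIndependent_iff.1 hliB c ?_ j)
    calc ∑ j, c j • d j = ∑ i, (C *ᵥ c) i • β i := by
          simp_rw [hd, Finset.smul_sum, smul_smul]
          rw [Finset.sum_comm]
          refine Finset.sum_congr rfl fun i _ => ?_
          rw [← Finset.sum_smul, Matrix.mulVec, dotProduct]
          exact congrArg (· • β i) (Finset.sum_congr rfl fun j _ => mul_comm _ _)
      _ = 0 := by simp [hc]
  -- the matrix `R σ` of `ρ σ` in the basis `bM`, and the action of `σ` on `β`
  obtain ⟨R, hR⟩ : ∃ R : Γ → Matrix (Fin (Module.finrank P M)) (Fin (Module.finrank P M)) P,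
      ∀ σ i, ρ σ (bM i) = ∑ k, R σ k i • bM k :=
    ⟨fun σ => LinearMap.toMatrix bM bM (ρ σ), fun σ i => by
      have h1 := Matrix.toLin_self bM bM (LinearMap.toMatrix bM bM (ρ σ : M →ₗ[P] M)) i
      rwa [Matrix.toLin_toMatrix] at h1⟩
  have hβσ : ∀ σ i, 𝔅.tensorRep ρ σ (β i) = ∑ k, algebraMap P 𝔅.B (R σ k i) • β k := fun σ i => by
    rw [hβ, tensorRep_apply_tmul, smul_one, hR, TensorProduct.tmul_sum]
    refine Finset.sum_congr rfl fun k _ => ?_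
    rw [TensorProduct.tmul_smul, algebraMap_smul, hβ]
  -- invariance of the `d j`: `ρ(σ) σ(C) = C`
  have hC : ∀ σ, (R σ).map (algebraMap P 𝔅.B) * σ • C = C := fun σ => by
    refine Matrix.ext fun k j => ?_
    have h1 : 𝔅.tensorRep ρ σ (d j) = ∑ k, ((R σ).map (algebraMap P 𝔅.B) * σ • C) k j • β k := by
      rw [hd j, map_sum]
      simp_rw [tensorRep_apply_smul, hβσ, Finset.smul_sum, smul_smul]
      rw [Finset.sum_comm]
      refine Finset.sum_congr rfl fun k _ => ?_
      rw [← Finset.sum_smul, Matrix.mul_apply]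
      refine congrArg (· • β k) (Finset.sum_congr rfl fun i _ => ?_)
      rw [Matrix.map_apply, Matrix.smul_apply, mul_comm]
    have h2 := β.repr_sum_self fun k => ((R σ).map (algebraMap P 𝔅.B) * σ • C) k j
    rw [← h1, (𝔅.mem_D_iff ρ _).1 (hdD j) σ] at h2
    rw [hCdef k j]
    exact (congrFun h2 k).symm
  -- hence `det C` is a period of `det ρ`, so a unit
  have hper : ∀ σ, algebraMap P 𝔅.B (R σ).det * σ • C.det = C.det := fun σ => by
    have h1 : σ • C.det = (σ • C).det := by
      have h2 := RingHom.map_det (MulSemiringAction.toRingHom Γ 𝔅.B σ) C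
      rw [MulSemiringAction.toRingHom_apply, RingHom.mapMatrix_apply] at h2
      exact h2.trans (congrArg Matrix.det (Matrix.ext fun i j => by
        rw [Matrix.map_apply, MulSemiringAction.toRingHom_apply, Matrix.smul_apply]))
    rw [h1, RingHom.map_det, RingHom.mapMatrix_apply, ← Matrix.det_mul, hC σ]
  obtain ⟨u, hu⟩ := (Matrix.isUnit_iff_isUnit_det C).2 (𝔅.isUnit_of_period hdet0 hper)
  -- so the `β i` are `B`-combinations of the `d j`
  have hβd : ∀ i, β i = ∑ j, ((u⁻¹ : (Matrix (Fin (Module.finrank P M))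
      (Fin (Module.finrank P M)) 𝔅.B)ˣ) : Matrix _ _ 𝔅.B) j i • d j := fun i => by
    have hCC : ∀ k, ∑ j, ((u⁻¹ : (Matrix (Fin (Module.finrank P M)) (Fin (Module.finrank P M))
        𝔅.B)ˣ) : Matrix _ _ 𝔅.B) j i * C k j =
        (1 : Matrix (Fin (Module.finrank P M)) (Fin (Module.finrank P M)) 𝔅.B) k i := fun k => by
      rw [← u.mul_inv, Matrix.mul_apply, hu]
      exact Finset.sum_congr rfl fun j _ => mul_comm _ _
    symm
    simp_rw [hd, Finset.smul_sum, smul_smul]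
    rw [Finset.sum_comm]
    simp_rw [← Finset.sum_smul, hCC, Matrix.one_apply, ite_smul, one_smul, zero_smul,
      Finset.sum_ite_eq', Finset.mem_univ, if_true]
  have hspan : ⊤ ≤ Submodule.span 𝔅.B (Set.range d) := by
    rw [← β.span_eq, Submodule.span_le]
    rintro _ ⟨i, rfl⟩
    rw [hβd i]
    exact Submodule.sum_mem _ fun j _ => Submodule.smul_mem _ _ (Submodule.subset_span ⟨j, rfl⟩)
  exact ⟨Module.Basis.mk hliB hspan, fun j => by rw [Module.Basis.mk_apply]; exact hdD j⟩

/-- **`α_V` is surjective for admissible `V`**: if `V` is `B`-admissible then `D_B(V)` spans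
`B ⊗_P V` over `B` (Fontaine, Exp. III, Thm. 1.5.2, from `exists_basis_mem_D_of_isAdmissible`), for
every regular `B` (the tree's `span_D_eq_top` is the case of a period FIELD `B`, by counting).
[cite: FontaineAsterisque223III, Exp. III Thm. 1.5.2] -/
theorem span_D_eq_top_of_isAdmissible [FiniteDimensional P M] (h : 𝔅.IsAdmissible ρ) :
    Submodule.span 𝔅.B (𝔅.D ρ : Set (𝔅.B ⊗[P] M)) = ⊤ := by
  obtain ⟨b, hb⟩ := 𝔅.exists_basis_mem_D_of_isAdmissible ρ h
  refine eq_top_iff.2 ?_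
  rw [← b.span_eq, Submodule.span_le]
  rintro _ ⟨j, rfl⟩
  exact Submodule.subset_span (hb j)

/-- **Conversely, `α_V` surjective implies admissible**: if `D_B(V)` spans `B ⊗_P V` over `B` then `V`
is `B`-admissible — an `E`-basis of `D_B(V)` then spans the free `B`-module `B ⊗_P V` of rank `dim_P V`
(strong rank condition for the commutative ring `B`), so `dim_P V ≤ dim_E D_B(V)`, and Fontaine's
inequality (accepted `finrank_D_le_holds`) gives equality.  Fontaine, Exp. III, Thm. 1.5.2.
[cite: FontaineAsterisque223III, Exp. III Thm. 1.5.2] -/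
theorem isAdmissible_of_span_D_eq_top [FiniteDimensional P M]
    (h : Submodule.span 𝔅.B (𝔅.D ρ : Set (𝔅.B ⊗[P] M)) = ⊤) : 𝔅.IsAdmissible ρ := by
  haveI := 𝔅.finite_D ρ
  let bD := Module.finBasis E (𝔅.D ρ)
  have h1 : Submodule.span 𝔅.B (Set.range fun j => (bD j : 𝔅.B ⊗[P] M)) = ⊤ := by
    refine eq_top_iff.2 ?_
    rw [← h, Submodule.span_le]
    intro x hx
    have hx' : x = ∑ j, bD.repr ⟨x, hx⟩ j • (bD j : 𝔅.B ⊗[P] M) := by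
      have h2 := congrArg Subtype.val (bD.sum_repr ⟨x, hx⟩)
      rw [Submodule.coe_sum] at h2
      exact h2.symm
    rw [hx']
    exact Submodule.sum_mem _ fun j _ =>
      Submodule.smul_of_tower_mem _ _ (Submodule.subset_span ⟨j, rfl⟩)
  have h2 := finrank_range_le_card (R := 𝔅.B) fun j => (bD j : 𝔅.B ⊗[P] M)
  change Module.finrank 𝔅.B (Submodule.span 𝔅.B (Set.range fun j => (bD j : 𝔅.B ⊗[P] M))) ≤ _
    at h2
  rw [h1, finrank_top, Module.finrank_baseChange, Fintype.card_fin] at h2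
  exact le_antisymm (𝔅.finrank_D_le_holds ρ) h2

/-- **Fontaine's criterion** (Exp. III, Thm. 1.5.2): a finite-dimensional `V` is `B`-admissible iff
`D_B(V)` spans `B ⊗_P V` over `B` (iff the comparison map `α_V` is an isomorphism).
[cite: FontaineAsterisque223III, Exp. III Thm. 1.5.2] -/
theorem isAdmissible_iff_span_D_eq_top [FiniteDimensional P M] :
    𝔅.IsAdmissible ρ ↔ Submodule.span 𝔅.B (𝔅.D ρ : Set (𝔅.B ⊗[P] M)) = ⊤ :=
  ⟨𝔅.span_D_eq_top_of_isAdmissible ρ, 𝔅.isAdmissible_of_span_D_eq_top ρ⟩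

end Comparison

/-! ### 2. `⊗`-stability of admissibility (equivariant pairings) -/

section Pairing

variable {M₁ : Type*} [AddCommGroup M₁] [Module P M₁] [TopologicalSpace M₁]
  {M₂ : Type*} [AddCommGroup M₂] [Module P M₂] [TopologicalSpace M₂]
  {M₃ : Type*} [AddCommGroup M₃] [Module P M₃] [TopologicalSpace M₃]
  (ρ₁ : ContinuousRep Γ P M₁) (ρ₂ : ContinuousRep Γ P M₂) (ρ₃ : ContinuousRep Γ P M₃)

/-- **An equivariant pairing extends to an equivariant `B`-bilinear pairing of the `B ⊗_P Vᵢ`.**  If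
`φ : V₁ × V₂ → V₃` is `P`-bilinear with `φ(ρ₁(σ)x, ρ₂(σ)y) = ρ₃(σ) φ(x, y)` and `μ` is its `B`-bilinear
extension (`μ(b ⊗ x, c ⊗ y) = bc ⊗ φ(x, y)`), then `σ(μ(s, t)) = μ(σ s, σ t)` for the diagonal actions.
[folklore] -/
theorem pairing_tensorRep (φ : M₁ →ₗ[P] M₂ →ₗ[P] M₃)
    (hφ : ∀ (σ : Γ) (x : M₁) (y : M₂), φ (ρ₁ σ x) (ρ₂ σ y) = ρ₃ σ (φ x y))
    (μ : 𝔅.B ⊗[P] M₁ →ₗ[𝔅.B] 𝔅.B ⊗[P] M₂ →ₗ[𝔅.B] 𝔅.B ⊗[P] M₃)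
    (hμ : ∀ (b c : 𝔅.B) (x : M₁) (y : M₂), μ (b ⊗ₜ x) (c ⊗ₜ y) = (b * c) ⊗ₜ φ x y)
    (σ : Γ) (s : 𝔅.B ⊗[P] M₁) (t : 𝔅.B ⊗[P] M₂) :
    𝔅.tensorRep ρ₃ σ (μ s t) = μ (𝔅.tensorRep ρ₁ σ s) (𝔅.tensorRep ρ₂ σ t) := by
  induction s using TensorProduct.induction_on with
  | zero => simp only [map_zero, LinearMap.zero_apply]
  | tmul b x =>
    induction t using TensorProduct.induction_on with
    | zero => simp only [map_zero]
    | tmul c y =>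
      rw [hμ, tensorRep_apply_tmul, tensorRep_apply_tmul, tensorRep_apply_tmul, hμ, smul_mul', hφ]
    | add t t' ht ht' => simp only [map_add, ht, ht']
  | add s s' hs hs' => simp only [map_add, LinearMap.add_apply, hs, hs']

/-- **… hence pairs `D_B(V₁) × D_B(V₂)` into `D_B(V₃)`.** [folklore] -/
theorem pairing_mem_D (φ : M₁ →ₗ[P] M₂ →ₗ[P] M₃)
    (hφ : ∀ (σ : Γ) (x : M₁) (y : M₂), φ (ρ₁ σ x) (ρ₂ σ y) = ρ₃ σ (φ x y))
    (μ : 𝔅.B ⊗[P] M₁ →ₗ[𝔅.B] 𝔅.B ⊗[P] M₂ →ₗ[𝔅.B] 𝔅.B ⊗[P] M₃)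
    (hμ : ∀ (b c : 𝔅.B) (x : M₁) (y : M₂), μ (b ⊗ₜ x) (c ⊗ₜ y) = (b * c) ⊗ₜ φ x y)
    {s : 𝔅.B ⊗[P] M₁} (hs : s ∈ 𝔅.D ρ₁) {t : 𝔅.B ⊗[P] M₂} (ht : t ∈ 𝔅.D ρ₂) :
    μ s t ∈ 𝔅.D ρ₃ :=
  (𝔅.mem_D_iff ρ₃ _).2 fun σ => by
    rw [𝔅.pairing_tensorRep ρ₁ ρ₂ ρ₃ φ hφ μ hμ σ, (𝔅.mem_D_iff ρ₁ s).1 hs σ,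
      (𝔅.mem_D_iff ρ₂ t).1 ht σ]

/-- **`⊗`-stability of `B`-admissibility, pairing form** (Fontaine, Exp. III, Prop. 1.5.2: the
`B`-admissible representations of a regular `(P, Γ)`-ring form a sub-Tannakian category).  Let
`V₁, V₂, V₃` be finite-dimensional `P`-linear representations of `Γ` and `φ : V₁ × V₂ → V₃` a `P`-bilinear
`Γ`-equivariant pairing whose values span `V₃` (so `V₃` is a quotient of `V₁ ⊗_P V₂`: e.g. `V₁ ⊗_P V₂`
itself, `V₁ ⊗_L V₂` for `L`-linear representations, the twist of `V₂` by a character on a line `V₁`).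
If `V₁` and `V₂` are `B`-admissible then so is `V₃`.  Proof: by the comparison isomorphism
(`span_D_eq_top_of_isAdmissible`) `D(V₁)`, `D(V₂)` span `B ⊗ V₁`, `B ⊗ V₂` over `B`; the
`B`-bilinear extension `μ` of `φ` pairs `D(V₁) × D(V₂)` into `D(V₃)` and `μ(B ⊗ V₁, B ⊗ V₂)`
spans `B ⊗ V₃`, so `D(V₃)` spans
`B ⊗ V₃` and `V₃` is admissible (`isAdmissible_of_span_D_eq_top`).
[cite: FontaineAsterisque223III, Exp. III Prop. 1.5.2] [cite: FontaineOuyang2022, Thm. 2.13] -/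
theorem isAdmissible_of_pairing [FiniteDimensional P M₁] [FiniteDimensional P M₂]
    [FiniteDimensional P M₃] (φ : M₁ →ₗ[P] M₂ →ₗ[P] M₃)
    (hφ : ∀ (σ : Γ) (x : M₁) (y : M₂), φ (ρ₁ σ x) (ρ₂ σ y) = ρ₃ σ (φ x y))
    (hsurj : Submodule.span P (Set.image2 (fun x y => φ x y) Set.univ Set.univ) = ⊤)
    (h₁ : 𝔅.IsAdmissible ρ₁) (h₂ : 𝔅.IsAdmissible ρ₂) : 𝔅.IsAdmissible ρ₃ := by
  obtain ⟨μ, hμ⟩ := exists_baseChange_bilinear 𝔅.B φ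
  -- `μ(B ⊗ V₁, B ⊗ V₂) = μ(span D(V₁), span D(V₂)) ⊆ span D(V₃)`
  have hD : Submodule.map₂ μ ⊤ ⊤ ≤ Submodule.span 𝔅.B (𝔅.D ρ₃ : Set (𝔅.B ⊗[P] M₃)) := by
    rw [← 𝔅.span_D_eq_top_of_isAdmissible ρ₁ h₁, ← 𝔅.span_D_eq_top_of_isAdmissible ρ₂ h₂,
      Submodule.map₂_span_span]
    refine Submodule.span_mono ?_
    rintro _ ⟨s, hs, t, ht, rfl⟩
    exact 𝔅.pairing_mem_D ρ₁ ρ₂ ρ₃ φ hφ μ hμ hs ht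
  -- `μ(B ⊗ V₁, B ⊗ V₂)` contains every `b ⊗ φ(x, y)`, and these span `B ⊗ V₃`
  have htop : (⊤ : Submodule 𝔅.B (𝔅.B ⊗[P] M₃)) ≤ Submodule.map₂ μ ⊤ ⊤ := by
    rintro z -
    induction z using TensorProduct.induction_on with
    | zero => exact zero_mem _
    | tmul b z =>
      have hz : z ∈ Submodule.span P (Set.image2 (fun x y => φ x y) Set.univ Set.univ) := by
        rw [hsurj]
        exact Submodule.mem_top
      induction hz using Submodule.span_induction with
      | mem z hz =>
        obtain ⟨x, -, y, -, rfl⟩ := hz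
        have h1 : b ⊗ₜ[P] φ x y = μ (b ⊗ₜ x) (1 ⊗ₜ y) := by rw [hμ, mul_one]
        rw [h1]
        exact Submodule.apply_mem_map₂ μ Submodule.mem_top Submodule.mem_top
      | zero =>
        rw [TensorProduct.tmul_zero]
        exact zero_mem _
      | add z z' _ _ hz hz' =>
        rw [TensorProduct.tmul_add]
        exact add_mem hz hz'
      | smul a z _ hz =>
        rw [TensorProduct.tmul_smul]
        exact Submodule.smul_of_tower_mem _ a hz
    | add z z' hz hz' => exact add_mem hz hz'
  exact 𝔅.isAdmissible_of_span_D_eq_top ρ₃ (eq_top_iff.2 (htop.trans hD))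

/-- **`⊗`-stability of `B`-admissibility** (Fontaine, Exp. III, Prop. 1.5.2): if `V₁`, `V₂` are
finite-dimensional `B`-admissible representations and `ρ₃` is the diagonal representation
`σ(x ⊗ y) = ρ₁(σ)x ⊗ ρ₂(σ)y` on `V₁ ⊗_P V₂` (continuous for whatever topology the tensor product has
been given), then `V₁ ⊗_P V₂` is `B`-admissible (`isAdmissible_of_pairing` for the universal pairing).
[cite: FontaineAsterisque223III, Exp. III Prop. 1.5.2] -/
theorem isAdmissible_tmul [FiniteDimensional P M₁] [FiniteDimensional P M₂]
    [TopologicalSpace (M₁ ⊗[P] M₂)] (ρ₁₂ : ContinuousRep Γ P (M₁ ⊗[P] M₂))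
    (h : ∀ (σ : Γ) (x : M₁) (y : M₂), ρ₁₂ σ (x ⊗ₜ y) = ρ₁ σ x ⊗ₜ ρ₂ σ y)
    (h₁ : 𝔅.IsAdmissible ρ₁) (h₂ : 𝔅.IsAdmissible ρ₂) : 𝔅.IsAdmissible ρ₁₂ := by
  refine 𝔅.isAdmissible_of_pairing ρ₁ ρ₂ ρ₁₂ (TensorProduct.mk P M₁ M₂)
    (fun σ x y => by rw [TensorProduct.mk_apply, TensorProduct.mk_apply, h]) ?_ h₁ h₂
  refine eq_top_iff.2 ?_
  rintro z -
  induction z using TensorProduct.induction_on with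
  | zero => exact zero_mem _
  | tmul x y => exact Submodule.subset_span ⟨x, Set.mem_univ _, y, Set.mem_univ _, rfl⟩
  | add z z' hz hz' => exact add_mem hz hz'

end Pairing

/-! ### 3. Framed form: twisting by an `E'`-valued admissible character -/

section Framed

variable {E' : Type*} [Field E'] [Algebra P E'] [TopologicalSpace E'] [IsTopologicalRing E'] {n : ℕ}

/-- **Twist of an admissible framed representation by an admissible character, coefficients in a
finite extension `E'` of `P`** (Fontaine, Exp. III, Prop. 1.5.2, `⊗`-stability).  If the
`P`-restrictions (accepted `FramedRep.restrictScalars`) of `rE : Γ →ₜ* GL_n(E')` and of the character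
`r₁ : Γ →ₜ* GL_1(E')` are `B`-admissible, then so is the `P`-restriction of the twist `rE ⊗ det r₁`
(accepted `FramedRep.twist`, `FramedRep.det`; `det r₁(σ) = r₁(σ)₀₀`): the pairing
`(y, x) ↦ y₀ • x : E'^1 × E'^n → E'^n` is `P`-bilinear, equivariant for `r₁`, `rE`, `rE ⊗ det r₁`,
and onto, so `isAdmissible_of_pairing` applies.  (The accepted `isAdmissible_of_twist` is the case of
a `P`-valued character; here the character takes values in `E'ˣ`.)
[cite: FontaineAsterisque223III, Exp. III Prop. 1.5.2] -/
theorem isAdmissible_restrictScalars_twist_det [FiniteDimensional P E'] (rE : FramedRep Γ E' n)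
    (r₁ : FramedRep Γ E' 1) (hρ : 𝔅.IsAdmissible (FramedRep.restrictScalars P rE))
    (hr : 𝔅.IsAdmissible (FramedRep.restrictScalars P r₁)) :
    𝔅.IsAdmissible (FramedRep.restrictScalars P (rE.twist (FramedRep.det r₁))) := by
  let φ : (Fin 1 → E') →ₗ[P] (Fin n → E') →ₗ[P] (Fin n → E') :=
    LinearMap.mk₂ P (fun y x => y 0 • x) (fun y y' x => by rw [Pi.add_apply, add_smul])
      (fun c y x => by rw [Pi.smul_apply, smul_assoc]) (fun y x x' => smul_add _ _ _)
      (fun c y x => smul_comm _ _ _)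
  have hφ : ∀ (σ : Γ) (y : Fin 1 → E') (x : Fin n → E'),
      φ (FramedRep.restrictScalars P r₁ σ y) (FramedRep.restrictScalars P rE σ x) =
        FramedRep.restrictScalars P (rE.twist (FramedRep.det r₁)) σ (φ y x) := by
    intro σ y x
    simp only [φ, LinearMap.mk₂_apply, FramedRep.restrictScalars_apply_apply]
    rw [FramedRep.coe_twist_apply, Matrix.smul_mulVec, Matrix.mulVec_smul, smul_smul,
      FramedRep.det_apply, Matrix.GeneralLinearGroup.val_det_apply, Matrix.det_fin_one]
    congr 1
    simp [Matrix.mulVec, dotProduct]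
  have hsurj : Submodule.span P (Set.image2 (fun y x => φ y x) Set.univ Set.univ) = ⊤ :=
    eq_top_iff.2 fun x _ => Submodule.subset_span
      ⟨fun _ => 1, Set.mem_univ _, x, Set.mem_univ _, by simp [φ]⟩
  exact 𝔅.isAdmissible_of_pairing _ _ _ φ hφ hsurj hr hρ

end Framed

end PeriodRingData

/-! ### 4. Finite models: coefficients and determinant -/

section Models

universe u

variable {K : Type u} [Field K] {ℓ : ℕ} [Fact ℓ.Prime] {n : ℕ}

/-- **A model over `E` is a model over every finite `E' ⊇ E`**: if `r = P (rE ⊗_E ℚ̄_ℓ) P⁻¹` then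
`r = P ((rE ⊗_E E') ⊗_{E'} ℚ̄_ℓ) P⁻¹` (accepted `FramedRep.baseChange_inclusion_baseChange_algebraMap`).
Deliberate dot-notation extension of the accepted `Literature.NumberTheory.Automorphic.HasQlModel`,
declared with its absolute name. [cite: BuzzardGeeLMS2014, §2.2] -/
theorem _root_.Literature.NumberTheory.Automorphic.HasQlModel.baseChange_inclusion
    {r : FramedGaloisRep K (PadicAlgCl ℓ) n} {E E' : IntermediateField ℚ_[ℓ] (PadicAlgCl ℓ)}
    {rE : FramedGaloisRep K E n} (h : HasQlModel r E rE) (hE : E ≤ E') :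
    HasQlModel r E' (rE.baseChange (IntermediateField.inclusion hE).toRingHom
      (continuous_intermediateField_inclusion hE)) := by
  obtain ⟨P, hP⟩ := h
  exact ⟨P, by rw [FramedRep.baseChange_inclusion_baseChange_algebraMap]; exact hP⟩

/-- **The determinant of a model is a model of the determinant**: if `r = P (rE ⊗_E ℚ̄_ℓ) P⁻¹` then
`det r(g) = det rE(g)` in `ℚ̄_ℓ` (the determinant is a class function and commutes with extension of
scalars).  Deliberate dot-notation extension of the accepted `HasQlModel`. [folklore] -/
theorem _root_.Literature.NumberTheory.Automorphic.HasQlModel.coe_det_apply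
    {r : FramedGaloisRep K (PadicAlgCl ℓ) n} {E : IntermediateField ℚ_[ℓ] (PadicAlgCl ℓ)}
    {rE : FramedGaloisRep K E n} (h : HasQlModel r E rE) (g : absoluteGaloisGroup K) :
    ((FramedRep.det r g : (PadicAlgCl ℓ)ˣ) : PadicAlgCl ℓ) =
      algebraMap E (PadicAlgCl ℓ) ((FramedRep.det rE g : (E : Type)ˣ) : E) := by
  obtain ⟨P, rfl⟩ := h
  rw [FramedRep.det_apply, FramedRep.det_apply, FramedRep.conj_apply, map_mul, map_mul, map_inv,
    mul_inv_cancel_comm, Matrix.GeneralLinearGroup.val_det_apply,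
    Matrix.GeneralLinearGroup.val_det_apply, FramedRep.coe_baseChange_apply, ← RingHom.mapMatrix_apply,
    ← RingHom.map_det]

end Models

/-! ### 5. The twist of a de Rham representation by a de Rham character is de Rham -/

section DeRham

variable {F : Type} [Field F] {ℓ : ℕ} [Fact ℓ.Prime]

-- Mathlib's own global value (nested instance problems on `𝔅.B ⊗[P] M`, see `PAdicHodgeProofs`).
set_option maxSynthPendingDepth 3 in
/-- **The twist of a de Rham representation by a de Rham character is de Rham** (Fontaine, Exp. III,
Prop. 1.5.2: `⊗`-stability of `B`-admissibility, for every regular `(ℚ_ℓ, Γ_F)`-ring).  Let `alg` be a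
`ℚ_ℓ`-structure on the field `F`, `𝔅` a period-ring datum for `Γ_F` over `ℚ_ℓ` with invariant field `F`
(intended `B_dR(F)`), `ρ : Γ_F →ₜ* GL_n(ℚ̄_ℓ)` and `r : Γ_F →ₜ* GL_1(ℚ̄_ℓ)` both de Rham for `(alg, 𝔅)`
(accepted `FramedRep.IsDeRhamWith`: some finite model has `𝔅`-admissible `ℚ_ℓ`-restriction).  Then the
twist `ρ ⊗ det r` (accepted `FramedRep.twist`; `det r = r` as a `ℚ̄_ℓˣ`-valued character) is de Rham for
`(alg, 𝔅)`.  Proof: move finite models `rE₁` of `ρ` over `E₁` and `rE₂` of `r` over `E₂` to the compositum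
`E = E₁E₂ ⊆ ℚ̄_ℓ` (finite over `ℚ_ℓ`), where they are admissible by model independence (accepted
`isAdmissible_of_hasQlModel`); `rE₁ ⊗ det rE₂` is a model of `ρ ⊗ det r` over `E` (accepted
`HasQlModel.twist`, `HasQlModel.coe_det_apply`) with admissible `ℚ_ℓ`-restriction
(`isAdmissible_restrictScalars_twist_det`). [cite: FontaineAsterisque223III, Exp. III Prop. 1.5.2] -/
theorem FramedRep.IsDeRhamWith.twist_det (alg : Algebra ℚ_[ℓ] F)
    (𝔅 : PeriodRingData.{0, 0, 0, 0} (absoluteGaloisGroup F) ℚ_[ℓ] F) {n : ℕ}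
    {ρ : FramedRep (absoluteGaloisGroup F) (PadicAlgCl ℓ) n}
    {r : FramedRep (absoluteGaloisGroup F) (PadicAlgCl ℓ) 1}
    (hρ : ρ.IsDeRhamWith alg 𝔅) (hr : r.IsDeRhamWith alg 𝔅) :
    (ρ.twist (FramedRep.det r)).IsDeRhamWith alg 𝔅 := by
  letI := alg
  obtain ⟨E₁, hE₁, rE₁, hm₁, -⟩ := id hρ
  obtain ⟨E₂, hE₂, rE₂, hm₂, -⟩ := id hr
  haveI := hE₁
  haveI := hE₂
  have h₁ : E₁ ≤ E₁ ⊔ E₂ := le_sup_left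
  have h₂ : E₂ ≤ E₁ ⊔ E₂ := le_sup_right
  have hmE₁ := hm₁.baseChange_inclusion h₁
  have hmE₂ := hm₂.baseChange_inclusion h₂
  refine ⟨E₁ ⊔ E₂, inferInstance, _, hmE₁.twist _ (FramedRep.det r) hmE₂.coe_det_apply, ?_⟩
  exact 𝔅.isAdmissible_restrictScalars_twist_det _ _ (hρ.isAdmissible_of_hasQlModel alg 𝔅 hmE₁)
    (hr.isAdmissible_of_hasQlModel alg 𝔅 hmE₂)

/-- **The twist of a de Rham representation by a de Rham character is de Rham, for a `p`-adic Hodge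
datum** (accepted `PstWeilDeligneData`, `IsDeRhamFramed`): for every non-archimedean local field `F`,
prime `ℓ` and datum `𝔇 : PstWeilDeligneData F ℓ`, if `ρ : Γ_F →ₜ* GL_n(ℚ̄_ℓ)` and
`r : Γ_F →ₜ* GL_1(ℚ̄_ℓ)` are de Rham for `𝔇` then so is `ρ ⊗ det r` (Fontaine, Exp. III, Prop. 1.5.2;
`FramedRep.IsDeRhamWith.twist_det` for `(𝔇.algebra, 𝔇.𝔅)`).
[cite: FontaineAsterisque223III, Exp. III Prop. 1.5.2] -/
theorem PstWeilDeligneData.IsDeRhamFramed.twist_det [ValuativeRel F] [TopologicalSpace F]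
    [IsNonarchimedeanLocalField F] {𝔇 : PstWeilDeligneData F ℓ} {n : ℕ}
    {ρ : FramedRep (absoluteGaloisGroup F) (PadicAlgCl ℓ) n}
    {r : FramedRep (absoluteGaloisGroup F) (PadicAlgCl ℓ) 1}
    (hρ : 𝔇.IsDeRhamFramed ρ) (hr : 𝔇.IsDeRhamFramed r) :
    𝔇.IsDeRhamFramed (ρ.twist (FramedRep.det r)) :=
  FramedRep.IsDeRhamWith.twist_det 𝔇.algebra 𝔇.𝔅 hρ hr

end DeRham

end Literature.NumberTheory.GaloisRepresentations

end
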